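import Literature.MathematicalPhysics.QuantumFieldTheory.Balaban1983to89.B15Prop1Thm1RowsOfExistsUnique

/-!
# `Balaban1983to89.B15Prop1Thm1RowsOfExistsUniquePos` — [Balaban1985Variational] = «[15]», Thm 1 p. 279, (1)–(7) pp. 277–278; [Balaban1988Convergent] = «[III]», (2.1) p. 254, (2.12)–(2.13)
# pp. 256–257, (2.18) p. 257; [Balaban1989LargeFieldI] = «[IV]», (1.74) p. 192, Prop. 1 p. 194: THE LENGTH-GUARDED EDITION OF `B15Prop1Thm1RowsOfExistsUnique` §3–§4 — the rows (E) and (T1@q₀)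
# of the (J0′) producer for every base field, from `h15T` + the existence ∕ uniqueness letter RESTRICTED TO PRINT'S LENGTHS `0 < k'`

Honest framing: statement-level skeleton of published theorems with citation tags; proofs where landed; nothing here is a claim about the Yang–Mills mass gap.  Cell `pub-ymgap`
(HUMAN RULINGS D-0062 ∕ D-0149), lane `pub-ymgap-dag-n12-c` g29 (R134 seat (a), N12 = [B15], s1); count-neutral helper of K1⁹ `stmt-QuantumFields-27364` (`--kind proof --supports`);
N12 NOT discharged; one finite 𝕋⁴ programme at fixed ε; nothing continuum ∕ ℝ⁴ ∕ OS ∕ mass-gap ∕ Clay.  THEOREMS ONLY (0 `def`, 0 `instance`, 0 `sorry`).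

WHY (the repair half of the lane's g29 typing-strength finding).  The parent module's §3 `thm1Rows_atZ_of_thm1TorusClass_existsUnique` (p729581) and the knit heads that display its
letters verbatim (`Summits/…/BalabanUVNodesN12MinimiserFamilyKnitRowThm1Letters(OnZ)(OfRecord)`) carry the existence ∕ uniqueness half of [15] Theorem 1 as ONE closed letter `h15EUT`
quantified over ALL lengths `k' ≤ m + K` of r11's (2.18) index.  At `k' = 0` — where print's problem is trivial (`𝔅₀ = {Λ₀ = Ω₀}` pins `U = V`; Thm 1's induction starts at `k = 1`) but
the tree's index is the EMPTY sequence whose (2.2) determining set is EMPTY (`gammaRegion Ω 0 0 = Ω 0 = ∅`, the `i = k` branch) — the uniqueness clause fails (flat configuration versus its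
't Hooft centre twist): `B15Prop1Thm1LetterLengthZero.not_thm1TorusClassEU_allLengths` (kernel).  So every theorem displaying the unguarded letter is VACUOUS AS TYPED.  THIS FILE is the
repaired edition: the SAME theorem with the letter restricted to `0 < k'` (`h15EUT⁺`; there the tree's `Γ₀ = (Ω₁)ᶜ` agrees with print) —
the parent's proof goes through VERBATIM because it calls the letter only at the instance's own length `k' = k i ≥ 1` (`hk0`) — and the length-guarded twin of the parent's §4 (NODE 00's
house shape serves `h15EUT⁺`).  Consumers re-key ONE binder (`h15EUT ↦ h15EUT⁺`: insert `0 < k' →` after `∀ k'`) and call `…_pos`.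

CONTENTS.  §1 `eta_pos` (private, re-proved); §2 ★★★ `thm1Rows_atZ_of_thm1TorusClass_existsUnique_pos`; §3 ★★ `thm1TorusClassEU_pos_of_thm1RecordEU_pos`.

HONEST SCOPE.  Bookkeeping by name over landed modules; [15] Theorem 1 ((8) = `h15T`, existence ∕ uniqueness = `h15EUT⁺`, k ≥ 1) stays DISPLAYED, nothing of Bałaban's asserted; the
uniqueness clause is the WEAKER tower-central one (central ⊇ residual); whether `h15EUT⁺` is inhabited at the record's numerics is N07's ∕ NODE 00's business (no producer in the tree);
count-neutral; N12 NOT discharged; K0⁷ ∕ K1⁹ NOT closed; counts unmoved; R4 closes only the conditional finite-𝕋⁴ rung `BalabanLadder.UV` — no summit statement is proved here and NOT the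
Yang–Mills mass gap (Clay); nothing continuum ∕ ℝ⁴ ∕ OS.
-/

noncomputable section

open Set

namespace Literature.MathematicalPhysics.QuantumFieldTheory.Balaban1983to89.B15Prop1Thm1RowsOfExistsUniquePos

open T4Continuum B15DeterminingSets GaugeField B15Prop1Carrier B8Eq17ClassAkV1 BlockAveraging
open B14.Eq22Determines (blockIter IsBlockUnion)
open Literature.MathematicalPhysics.QuantumFieldTheory.BalabanImbrieJaffe1984to88.BIJ85Eq453GaugeField (qsstarGIter0)
open B15Prop1DatumSmall7AtZSequence B15Prop1Thm1GeneralFormAtZSequence B15Prop1Thm1GeneralFormShapes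
open B16Sect1Backgrounds (toMS)
open B15Prop1Thm1RowsOfExistsUnique

/-! ## §1  `η_j > 0` -/

section Eta

variable {F : T4Family}

/-- `0 < η_j` (`η_j = L^{−j}`, `L ≥ 1`). [folklore] -/
private theorem eta_pos (K j : ℕ) : 0 < (F.P K).eta j := by
  have hL : (0 : ℝ) < (F.P K).L := by exact_mod_cast (F.P K).L_pos
  unfold Params.eta
  positivity

end Eta

/-! ## §2  At print's (1.74) object: the rows (E) and (T1@q₀) for EVERY base field of the strict guard, from `h15T` + the LENGTH-GUARDED letter `h15EUT⁺` (§3 of the parent, verbatim but for one binder) -/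

section AtZ

open Classical
open Metric
open B14DomainGeom (IsUnionOfCubes)
open B15Eq112TorusCover (cover)
open B14.Eq213MaximalDomains (side)
open B14.Eq213DetSet B15Sect1Instances B16Sect1Wilson B16Sect1Backgrounds
open T4CubeChartGnomonic (SU2)
open T4AxialGaugeSmallField (castSite boxPlaqs)
open B15Extension193 (extend)
open B15ShellGauge193 (shellGauge)
open B15ShellGauge193Local (dist1_plaqHol_extend_shellGauge_le)

/-- ★★★ **THE ROWS (E) AND (T1@q₀) OF «(J0′) OF RECORD» FOR EVERY BASE FIELD OF THE STRICT GUARD, FROM TWO CLOSED [15] LETTERS — LENGTH-GUARDED EDITION** (the parent's §3 with its existence ∕ uniqueness letter restricted to print's lengths `0 < k'`; the unguarded letter is unsatisfiable, `B15Prop1Thm1LetterLengthZero`) — K0⁷'s (8)-letter `h15T` ([15] Thm 1 (R) over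
the torus class, the text of `B15Prop1Thm1GeneralFormShapes.thm1Guarded_of_thm1TorusClass` :507–522) and the EXISTENCE ∕ UNIQUENESS letter `h15EUT⁺` (same antecedents PLUS `0 < k'`; conclusion
«∃ minimiser over class (6) at `ε₀`» ∧ «any two minimisers differ by a gauge with equal, central scale-`j` images at the two ends of every constrained bond»).  Per instance `i` of the
knit (`Z, Λ, k, lo, hi, ext`: the geometry rows of `nearValue_letter_of_thm1Guarded` VERBATIM), for every `0 < ε` with `(c_E+1)ε ≤ a₁`, every class tolerance `εr ≥ B₃(c_E+1)ε`, every
`ε₀` with `εr < ε₀ ≤ a₀`, and every base field `V_k` with `PlaqSmallOn (plaqsInside (pts k (Z ∩ Λᶜ))) ε V_k`: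
(E) `∃ U₀, IsMinimizer (M˙) (U_k({Ω_j(Z)}, εr)) (𝐁_k(Z)) (M˙(Q_k^{s*}(ext V_k))) U₀` — U2 :171–173 VERBATIM at `ν⟨εreg := εr⟩` — and, for EVERY such minimiser `U₀`,
(T1@q₀) over `reg' := closure (U_k({Ω_j(Z)}, εr))` — dag-n12-d (A″) :196–200 VERBATIM.
Proof: the parent's §3 proof verbatim (it calls the letter at `k' = k i ≥ 1`, `hk0`). [cite: Balaban1985Variational, (1) p.277, (2),(3),(5),(6),(7) p.278, Thm 1 (8) p.279; Balaban1988Convergent, (2.1) p.254, p.255, (2.12)–(2.13) pp.256–257, (2.18) p.257; Balaban1989LargeFieldI, (1.74) p.192, p.193 ll.14–20, Prop. 1 p.194; Balaban1989LargeFieldII, (1.12)–(1.13) p.359; Balaban1985RegularSpaces, (1.3)–(1.9) p.77] -/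
theorem thm1Rows_atZ_of_thm1TorusClass_existsUnique_pos {F : T4Family} (ν : Node00.Stage7Numerics) (Kt : ℕ) (hd3 : 3 ≤ (F.P Kt).d) {ι : Type}
    (Z Λ : ι → Set (Site (F.P Kt) 0)) (k : ι → ℕ) (hk0 : ∀ i, 0 < k i) (hk : ∀ i, k i ≤ (F.P Kt).m + (F.P Kt).K)
    (lo hi : ι → Fin (F.P Kt).d → ℤ) (n : ι → ℕ) (hn : ∀ i κ, hi i κ ≤ lo i κ + n i)
    (hbox : ∀ i, pts (k i) (Λ i) = (castSite '' Set.Icc (lo i) (hi i) : Set (Site (F.P Kt) (k i))))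
    (hZ : ∀ i, (boxPlaqs (lo i - 1) (hi i + 1) : Set (Plaq (F.P Kt) (k i))) ⊆ plaqsInside (pts (k i) (Z i)))
    (hN5 : ∀ i κ, ((hi i κ - lo i κ + 1).toNat : ℤ) + 5 < (F.P Kt).sitesPerDir (k i))
    (ext : ∀ i, GaugeField (F.P Kt) (k i) SU2 → GaugeField (F.P Kt) (k i) SU2)
    (hext : ∀ i Vk, ext i Vk = extend (pts (k i) (Λ i)) (shellGauge Vk (lo i) (hi i)) Vk)
    (hlohi : ∀ i, lo i ≤ hi i)
    -- (Gᵃ) geometry of `Z`: a union of `k`-blocks; print's `M₁ ≥ 2` and the torus divisibility of the `LʲM₁`-cube partitions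
    (hZblk : ∀ i, IsBlockUnion (k i) (Z i))
    (hM2 : 2 ≤ ν.M₁) (hdiv : ∀ i, side (F.P Kt).L ν.M₁ (k i) ∣ (F.P Kt).sitesPerDir 0)
    -- bookkeeping constants
    {cE B₃ a₀ a₁ : ℝ} (hcE0 : 0 ≤ cE) (hcE : ∀ i, 12 * ((F.P Kt).d : ℝ) * ((n i : ℝ) + 2) ^ 2 ≤ cE)
    -- [15] THEOREM 1 (R) = (8), CLOSED, OVER NODE 00's TORUS CLASS (shape (C); K0⁷'s `VariationalThm1RegSepCoP7M` via dag-n12-d's `thm1TorusClass_of_variationalThm1RegSepCoP7M`)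
    (h15T : ∀ (k' : ℕ), k' ≤ (F.P Kt).m + (F.P Kt).K → side (F.P Kt).L ν.M₁ k' ∣ (F.P Kt).sitesPerDir 0 →
      ∀ (s : B14.Eq218Concrete.Seq (fun n : ℕ => Node00.unionsOfCubes (F.P Kt) (side (F.P Kt).L ν.M₁ n)) k'),
      Node00.Sect2.SeqSeparated ν.M₁ s → 0 < ν.M₁ →
      ∀ (ε₀ : ℝ) (δ : ℕ → ℝ), (∀ j, j ≤ k' → 0 < δ j ∧ δ j ≤ a₁ ∧ B₃ * δ j ≤ ε₀) → (∀ j, j < k' → δ j ≤ 2 * δ (j + 1)) →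
      (∀ j, j < k' → δ (j + 1) ≤ 2 * δ j) → ε₀ ≤ a₀ →
      ∀ W : MSField (F.P Kt) SU2,
        Node00.Sect2.DataSmall7PTop (Node00.avOfRecord F 2 Kt) s.Ω (Node00.suppDomOfRecord F ν Kt s.Ω) k' δ W →
        ∀ U₀ : GaugeField (F.P Kt) 0 SU2, IsMinimizer (Node00.avOfRecord F 2 Kt)
            {U | (∀ j, j ≤ k' → PlaqSmallOn (Node00.Sect2.omegaPlaqsTop s.Ω (Node00.suppDomOfRecord F ν Kt s.Ω) j)
                (ε₀ * (F.P Kt).eta j ^ 2) U) ∧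
              Node00.Sect2.CoDivClassOnTop s.Ω (Node00.suppDomOfRecord F ν Kt s.Ω) k' ε₀ U}
            (genSet s.Ω k') W U₀ →
          (∀ j, j ≤ k' → PlaqSmallOn (Node00.Sect2.omegaPlaqsTop s.Ω (Node00.suppDomOfRecord F ν Kt s.Ω) j)
              (B₃ * δ j * (F.P Kt).eta j ^ 2) U₀) ∧
            ∀ j, j ≤ k' → Node00.Sect2.CoDivSmallOn (Node00.Sect2.omegaBondsTop s.Ω (Node00.suppDomOfRecord F ν Kt s.Ω) j)
              (B₃ * δ j * (F.P Kt).eta j ^ 3) U₀)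
    -- [15] THEOREM 1, EXISTENCE OF THE MINIMAL ORBIT ∕ UNIQUENESS MODULO TOWER-CENTRAL GAUGES, CLOSED, OVER NODE 00's TORUS CLASS AT PRINT'S LENGTHS `0 < k'` (shape (C); same antecedents)
    (h15EUT : ∀ (k' : ℕ), 0 < k' → k' ≤ (F.P Kt).m + (F.P Kt).K → side (F.P Kt).L ν.M₁ k' ∣ (F.P Kt).sitesPerDir 0 →
      ∀ (s : B14.Eq218Concrete.Seq (fun n : ℕ => Node00.unionsOfCubes (F.P Kt) (side (F.P Kt).L ν.M₁ n)) k'),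
      Node00.Sect2.SeqSeparated ν.M₁ s → 0 < ν.M₁ →
      ∀ (ε₀ : ℝ) (δ : ℕ → ℝ), (∀ j, j ≤ k' → 0 < δ j ∧ δ j ≤ a₁ ∧ B₃ * δ j ≤ ε₀) → (∀ j, j < k' → δ j ≤ 2 * δ (j + 1)) →
      (∀ j, j < k' → δ (j + 1) ≤ 2 * δ j) → ε₀ ≤ a₀ →
      ∀ W : MSField (F.P Kt) SU2,
        Node00.Sect2.DataSmall7PTop (Node00.avOfRecord F 2 Kt) s.Ω (Node00.suppDomOfRecord F ν Kt s.Ω) k' δ W →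
        (∃ U₀ : GaugeField (F.P Kt) 0 SU2, IsMinimizer (Node00.avOfRecord F 2 Kt)
            {U | (∀ j, j ≤ k' → PlaqSmallOn (Node00.Sect2.omegaPlaqsTop s.Ω (Node00.suppDomOfRecord F ν Kt s.Ω) j)
                (ε₀ * (F.P Kt).eta j ^ 2) U) ∧
              Node00.Sect2.CoDivClassOnTop s.Ω (Node00.suppDomOfRecord F ν Kt s.Ω) k' ε₀ U}
            (genSet s.Ω k') W U₀) ∧
        ∀ U₁ U₂ : GaugeField (F.P Kt) 0 SU2,
          IsMinimizer (Node00.avOfRecord F 2 Kt)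
            {U | (∀ j, j ≤ k' → PlaqSmallOn (Node00.Sect2.omegaPlaqsTop s.Ω (Node00.suppDomOfRecord F ν Kt s.Ω) j)
                (ε₀ * (F.P Kt).eta j ^ 2) U) ∧
              Node00.Sect2.CoDivClassOnTop s.Ω (Node00.suppDomOfRecord F ν Kt s.Ω) k' ε₀ U}
            (genSet s.Ω k') W U₁ →
          IsMinimizer (Node00.avOfRecord F 2 Kt)
            {U | (∀ j, j ≤ k' → PlaqSmallOn (Node00.Sect2.omegaPlaqsTop s.Ω (Node00.suppDomOfRecord F ν Kt s.Ω) j)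
                (ε₀ * (F.P Kt).eta j ^ 2) U) ∧
              Node00.Sect2.CoDivClassOnTop s.Ω (Node00.suppDomOfRecord F ν Kt s.Ω) k' ε₀ U}
            (genSet s.Ω k') W U₂ →
          ∃ u : GaugeTransf (F.P Kt) 0 SU2,
            (∀ j, j ≤ k' → ∀ b ∈ bondsOf (genSet s.Ω k' j), toMS u j b.src = toMS u j b.tgt ∧ ∀ g : SU2, toMS u j b.src * g = g * toMS u j b.src) ∧
              gaugeAct u U₁ = U₂) :
    ∀ i (εr ε₀ ε : ℝ) (Vk : GaugeField (F.P Kt) (k i) SU2), 0 < ε → (cE + 1) * ε ≤ a₁ → B₃ * ((cE + 1) * ε) ≤ εr → εr < ε₀ → ε₀ ≤ a₀ →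
      PlaqSmallOn (plaqsInside (pts (k i) (Z i ∩ (Λ i)ᶜ))) ε Vk →
      (∃ U₀ : GaugeField (F.P Kt) 0 SU2,
          IsMinimizer (Node00.avOfRecord F 2 Kt) (Node00.regMSCoPOfRecord F 2 {ν with εreg := εr} Kt (k i) (maxDomT ν.M₁ (Z i))) (Bj ν.M₁ (Z i) (k i))
            (avgFamily (Node00.avOfRecord F 2 Kt) (qsstarGIter0 (k i) (ext i Vk))) U₀) ∧
      ∀ U₀ : GaugeField (F.P Kt) 0 SU2,
        IsMinimizer (Node00.avOfRecord F 2 Kt) (Node00.regMSCoPOfRecord F 2 {ν with εreg := εr} Kt (k i) (maxDomT ν.M₁ (Z i))) (Bj ν.M₁ (Z i) (k i))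
            (avgFamily (Node00.avOfRecord F 2 Kt) (qsstarGIter0 (k i) (ext i Vk))) U₀ →
        ∀ U ∈ closure (Node00.regMSCoPOfRecord F 2 {ν with εreg := εr} Kt (k i) (maxDomT ν.M₁ (Z i))),
          AgreeOn (Bj ν.M₁ (Z i) (k i)) (avgFamily (Node00.avOfRecord F 2 Kt) U) (avgFamily (Node00.avOfRecord F 2 Kt) (qsstarGIter0 (k i) (ext i Vk))) →
          wilsonAction4 U ≤ wilsonAction4 U₀ →
            ∃ u : GaugeTransf (F.P Kt) 0 SU2,
              (∀ j, j ≤ k i → ∀ b ∈ bondsOf (Bj ν.M₁ (Z i) (k i) j), toMS u j b.src = toMS u j b.tgt ∧ ∀ g : SU2, toMS u j b.src * g = g * toMS u j b.src) ∧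
                gaugeAct u U = U₀ := by
  intro i εr ε₀ ε Vk hε hεa₁ hεr hr₀ ha₀ hreg
  have hd : 2 ≤ (F.P Kt).d := by omega
  have hM : 1 ≤ ν.M₁ := le_trans one_le_two hM2
  have hki : 1 ≤ k i := hk0 i
  -- `Z`'s maximal sequence as a separated (2.18) index, with print's cube letters, re-indexed over NODE 00's torus class
  obtain ⟨s, hsΩ, -, hscube, hsep⟩ := exists_seq_maxDomT hM (Z i) (hdiv i)
  obtain ⟨s', hΩ'⟩ := exists_seq_torusClass_of_cubeLetters hM s hscube
  have hsep' : Node00.Sect2.SeqSeparated ν.M₁ s' := (seqSeparated_iff_of_Ω_eq ν.M₁ hΩ').2 hsep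
  have hw1 : s.Ω 1 = maxDomT ν.M₁ (Z i) 1 := hsΩ 1 le_rfl hki
  -- (a) the p. 193 extension is `(cE+1)ε`-small on the `k`-plaquettes inside `Z`
  have hN3 : ∀ κ, hi i κ - lo i κ + 3 < ((F.P Kt).sitesPerDir (k i) : ℤ) := fun κ => by
    have h5 := hN5 i κ
    have hle : lo i κ ≤ hi i κ := hlohi i κ
    rw [Int.toNat_of_nonneg (by linarith)] at h5
    linarith
  have hδ₀ : 0 < (cE + 1) * ε := by positivity
  have hV : PlaqSmallOn (plaqsInside (pts (k i) (Z i))) ((cE + 1) * ε) (ext i Vk) := by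
    intro p hp
    rw [hext]
    have h := (dist1_plaqHol_extend_shellGauge_le hd3 (hlohi i) (hn i) hN3 (hbox i) (hZ i) hε hreg).1 p hp
    calc dist1 (plaqHol (extend (pts (k i) (Λ i)) (shellGauge Vk (lo i) (hi i)) Vk) p)
        ≤ 12 * (F.P Kt).d * (n i + 2) ^ 2 * ε := h
      _ ≤ cE * ε := mul_le_mul_of_nonneg_right (hcE i) hε.le
      _ < (cE + 1) * ε := by nlinarith
  -- (b) print's (7) for the datum ALONG THE INDEX `s.Ω`
  have h0 : Node00.Sect2.printedPlaqsTop s.Ω (Node00.suppDomOfRecord F ν Kt s.Ω) (k i) ⊆ plaqsInside (Z i) := by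
    rw [printedPlaqsTop_congr hki hsΩ, Node00.suppDomOfRecord_congr (F := F) ν Kt hw1]
    exact printedPlaqsTop_maxDomT_subset_plaqsInside hM (hdiv i) hki (k i)
  have hsucc : ∀ m, m + 1 ≤ k i → Node00.Sect2.printedPlaqs s.Ω (k i) (m + 1) ⊆ plaqsInside (pts (m + 1) (Z i)) := by
    intro m hm
    refine (Node00.Sect2.printedPlaqs_subset_plaqsOf _ _ _).trans ?_
    refine (plaqsOf_mono (genSet_subset_pts_of_one_le s.Ω (k i) (Nat.succ_pos m))).trans ?_
    rw [hsΩ (m + 1) (Nat.succ_pos m) hm]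
    exact plaqsOf_pts_maxDomT_subset_plaqsInside hM2 (hdiv i) (Nat.succ_pos m) hm
  have h7 : Node00.Sect2.DataSmall7PTop (Node00.avOfRecord F 2 Kt) s.Ω (Node00.suppDomOfRecord F ν Kt s.Ω) (k i)
      (fun _ => (cE + 1) * ε) (avgFamily (Node00.avOfRecord F 2 Kt) (qsstarGIter0 (k i) (ext i Vk))) :=
    dataSmall7PTop_avgFamily_qsstarGIter0 hd ExpMeanLog.expMeanLogSU T3DescentFibreTower.expMeanLogSU_E_one rfl (hk i)
      s.Ω _ (Z i) (hZblk i) h0 hsucc (fun _ _ => hδ₀) (ext i Vk) (fun _ _ => hV)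
  -- numerics of the thresholds at `ε₀`
  have hnum : ∀ j, j ≤ k i → 0 < (cE + 1) * ε ∧ (cE + 1) * ε ≤ a₁ ∧ B₃ * ((cE + 1) * ε) ≤ ε₀ := fun j _ =>
    ⟨hδ₀, hεa₁, hεr.trans hr₀.le⟩
  -- the two [15] letters at the index `s'`, read back at `s.Ω`, applied to the (1.74) datum
  have h8 := h15T (k i) (hk i) (hdiv i) s' hsep' hM
  have hEU := h15EUT (k i) (hk0 i) (hk i) (hdiv i) s' hsep' hM
  rw [hΩ'] at h8 hEU
  have h8W := h8 ε₀ (fun _ => (cE + 1) * ε) hnum (fun _ _ => by linarith) (fun _ _ => by linarith) ha₀ _ h7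
  obtain ⟨⟨Ustar, hUstar⟩, huniq⟩ := hEU ε₀ (fun _ => (cE + 1) * ε) hnum (fun _ _ => by linarith) (fun _ _ => by linarith) ha₀ _ h7
  clear h8 hEU
  -- (c) the (1.74) class and determining set at `maxDomT ν.M₁ Z` ARE those at the index `s`; the class literal at `ε₀` IS the class of record at `ν⟨εreg := ε₀⟩`
  rw [setOf_class_eq_regMSCoPOfRecord] at hUstar huniq h8W
  have hreg : ∀ e : ℝ, Node00.regMSCoPOfRecord F 2 {ν with εreg := e} Kt (k i) (maxDomT ν.M₁ (Z i)) =
      Node00.regMSCoPOfRecord F 2 {ν with εreg := e} Kt (k i) s.Ω := fun e => (regMSCoPOfRecord_congr F 2 _ Kt hki hsΩ).symm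
  have hB : Bj ν.M₁ (Z i) (k i) = genSet s.Ω (k i) := (genSet_congr hki hsΩ).symm
  -- the `ε₀`-minimiser `U*` is `B₃(cE+1)ε`-regular, hence in the class at `εr`
  have h8U := h8W Ustar hUstar
  have hUr : Ustar ∈ Node00.regMSCoPOfRecord F 2 {ν with εreg := εr} Kt (k i) s.Ω := by
    refine ⟨fun j hj p hp => ((h8U.1 j hj) p hp).trans_le ?_, fun j hj b hb => ((h8U.2 j hj) b hb).trans_le ?_⟩
    · exact mul_le_mul_of_nonneg_right hεr (pow_nonneg (eta_pos Kt j).le 2)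
    · exact mul_le_mul_of_nonneg_right hεr (pow_nonneg (eta_pos Kt j).le 3)
  have hsub : Node00.regMSCoPOfRecord F 2 {ν with εreg := εr} Kt (k i) s.Ω ⊆ Node00.regMSCoPOfRecord F 2 {ν with εreg := ε₀} Kt (k i) s.Ω :=
    regMSCoPOfRecord_mono_eps ν Kt (k i) s.Ω hr₀.le
  have hcl : closure (Node00.regMSCoPOfRecord F 2 {ν with εreg := εr} Kt (k i) s.Ω) ⊆ Node00.regMSCoPOfRecord F 2 {ν with εreg := ε₀} Kt (k i) s.Ω :=
    closure_regMSCoPOfRecord_subset_of_lt ν Kt (k i) s.Ω hr₀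
  refine ⟨⟨Ustar, ?_⟩, ?_⟩
  · -- (E) at `εr`
    rw [hreg εr, hB]
    exact isMinimizer_of_mem_of_subset (Node00.avOfRecord F 2 Kt) hUstar hsub hUr
  · -- (T1@q₀) at `εr`, for every minimiser `U₀`
    intro U₀ hU₀ U hU hUW hle
    rw [hreg εr, hB] at hU₀
    rw [hreg εr] at hU
    rw [hB] at hUW ⊢
    exact thm1Row_of_existsUnique (Node00.avOfRecord F 2 Kt)
      (fun U₁ U₂ => ∃ u : GaugeTransf (F.P Kt) 0 SU2,
        (∀ j, j ≤ k i → ∀ b ∈ bondsOf (genSet s.Ω (k i) j), toMS u j b.src = toMS u j b.tgt ∧ ∀ g : SU2, toMS u j b.src * g = g * toMS u j b.src) ∧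
          gaugeAct u U₁ = U₂)
      hsub hcl ⟨Ustar, hUstar, hUr⟩ huniq hU₀ U hU hUW hle

end AtZ

/-! ## §3  NODE 00's house shape, LENGTH-GUARDED: the (E/U) letter over the (2.18) index OF RECORD at lengths `0 < k'` serves the guarded torus-class letter `h15EUT⁺` -/

section HouseShape

open B14.Eq213MaximalDomains (side)
open T4CubeChartGnomonic (SU2)

/-- ★★ **THE LENGTH-GUARDED (E/U) LETTER IN NODE 00's HOUSE SHAPE SERVES `h15EUT⁺`**: the existence ∕ uniqueness sentence quantified like K0⁷'s `Node00.VariationalThm1RegSepCoP7M F 2 B₃ a₀ a₁` AT LENGTHS `0 < k'`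
(every numerics `ν`, basic cube size `M`, coupling history `g`, torus `K`, length `k`, separated (2.18) index `s : SeqOfRecord F ν M g K k` of record, `M₁ ≥ 1`, tolerances, datum
with (7) on the support of record — the (R)-reading's antecedents VERBATIM, its conclusion replaced by «∃ minimiser over class (6) at `ε₀`» ∧ «any two minimisers differ by a gauge with
equal, central scale-`j` images at the two ends of every constrained bond») READ AT `(ν, M := ν.M₁, g := 1, K := Kt)` IS the torus-class letter `h15EUT` of §3 at `(ν, Kt)` (its two
guards idle): `DOfRecord_at_flat` + dag-n12-c g15's `exists_seq_reindex_Ω` ∕ `seqSeparated_iff_of_Ω_eq` (every reader of the body reads `s.Ω` only) — the twin of dag-n12-d's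
`thm1TorusClass_of_variationalThm1RegSepCoP7M` for the (8)-letter.  So a NODE 00 def with this body (node00-def's pen; NOT filed here) would serve N12's (E)∕(T1@q₀) rows BY NAME.
[cite: Balaban1985Variational, (1) p.277, Thm 1 (2),(3),(5),(6),(7),(8) pp.278–279; Balaban1988Convergent, (2.1) p.254, (2.5) p.255, (2.12)–(2.13) p.256, (2.18) p.257; Balaban1985RegularSpaces, (1.3)–(1.9) p.77 (bookkeeping)] -/
theorem thm1TorusClassEU_pos_of_thm1RecordEU_pos {F : T4Family} (ν : Node00.Stage7Numerics) (Kt : ℕ) {B₃ a₀ a₁ : ℝ}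
    (h15EU : ∀ (ν' : Node00.Stage7Numerics) (M : ℕ) (g : ℕ → ℝ) (K k' : ℕ) (s : Node00.SeqOfRecord F ν' M g K k'), 0 < k' →
      Node00.Sect2.SeqSeparated ν'.M₁ s → 0 < ν'.M₁ →
      ∀ (ε₀ : ℝ) (δ : ℕ → ℝ), (∀ j, j ≤ k' → 0 < δ j ∧ δ j ≤ a₁ ∧ B₃ * δ j ≤ ε₀) → (∀ j, j < k' → δ j ≤ 2 * δ (j + 1)) →
      (∀ j, j < k' → δ (j + 1) ≤ 2 * δ j) → ε₀ ≤ a₀ →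
      ∀ W : MSField (F.P K) SU2,
        Node00.Sect2.DataSmall7PTop (Node00.avOfRecord F 2 K) s.Ω (Node00.suppDomOfRecord F ν' K s.Ω) k' δ W →
        (∃ U₀ : GaugeField (F.P K) 0 SU2, IsMinimizer (Node00.avOfRecord F 2 K)
            {U | (∀ j, j ≤ k' → PlaqSmallOn (Node00.Sect2.omegaPlaqsTop s.Ω (Node00.suppDomOfRecord F ν' K s.Ω) j)
                (ε₀ * (F.P K).eta j ^ 2) U) ∧
              Node00.Sect2.CoDivClassOnTop s.Ω (Node00.suppDomOfRecord F ν' K s.Ω) k' ε₀ U}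
            (genSet s.Ω k') W U₀) ∧
        ∀ U₁ U₂ : GaugeField (F.P K) 0 SU2,
          IsMinimizer (Node00.avOfRecord F 2 K)
            {U | (∀ j, j ≤ k' → PlaqSmallOn (Node00.Sect2.omegaPlaqsTop s.Ω (Node00.suppDomOfRecord F ν' K s.Ω) j)
                (ε₀ * (F.P K).eta j ^ 2) U) ∧
              Node00.Sect2.CoDivClassOnTop s.Ω (Node00.suppDomOfRecord F ν' K s.Ω) k' ε₀ U}
            (genSet s.Ω k') W U₁ →
          IsMinimizer (Node00.avOfRecord F 2 K)
            {U | (∀ j, j ≤ k' → PlaqSmallOn (Node00.Sect2.omegaPlaqsTop s.Ω (Node00.suppDomOfRecord F ν' K s.Ω) j)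
                (ε₀ * (F.P K).eta j ^ 2) U) ∧
              Node00.Sect2.CoDivClassOnTop s.Ω (Node00.suppDomOfRecord F ν' K s.Ω) k' ε₀ U}
            (genSet s.Ω k') W U₂ →
          ∃ u : GaugeTransf (F.P K) 0 SU2,
            (∀ j, j ≤ k' → ∀ b ∈ bondsOf (genSet s.Ω k' j), toMS u j b.src = toMS u j b.tgt ∧ ∀ g : SU2, toMS u j b.src * g = g * toMS u j b.src) ∧
              gaugeAct u U₁ = U₂) :
    ∀ (k' : ℕ), 0 < k' → k' ≤ (F.P Kt).m + (F.P Kt).K → side (F.P Kt).L ν.M₁ k' ∣ (F.P Kt).sitesPerDir 0 →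
      ∀ (s : B14.Eq218Concrete.Seq (fun n : ℕ => Node00.unionsOfCubes (F.P Kt) (side (F.P Kt).L ν.M₁ n)) k'),
      Node00.Sect2.SeqSeparated ν.M₁ s → 0 < ν.M₁ →
      ∀ (ε₀ : ℝ) (δ : ℕ → ℝ), (∀ j, j ≤ k' → 0 < δ j ∧ δ j ≤ a₁ ∧ B₃ * δ j ≤ ε₀) → (∀ j, j < k' → δ j ≤ 2 * δ (j + 1)) →
      (∀ j, j < k' → δ (j + 1) ≤ 2 * δ j) → ε₀ ≤ a₀ →
      ∀ W : MSField (F.P Kt) SU2,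
        Node00.Sect2.DataSmall7PTop (Node00.avOfRecord F 2 Kt) s.Ω (Node00.suppDomOfRecord F ν Kt s.Ω) k' δ W →
        (∃ U₀ : GaugeField (F.P Kt) 0 SU2, IsMinimizer (Node00.avOfRecord F 2 Kt)
            {U | (∀ j, j ≤ k' → PlaqSmallOn (Node00.Sect2.omegaPlaqsTop s.Ω (Node00.suppDomOfRecord F ν Kt s.Ω) j)
                (ε₀ * (F.P Kt).eta j ^ 2) U) ∧
              Node00.Sect2.CoDivClassOnTop s.Ω (Node00.suppDomOfRecord F ν Kt s.Ω) k' ε₀ U}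
            (genSet s.Ω k') W U₀) ∧
        ∀ U₁ U₂ : GaugeField (F.P Kt) 0 SU2,
          IsMinimizer (Node00.avOfRecord F 2 Kt)
            {U | (∀ j, j ≤ k' → PlaqSmallOn (Node00.Sect2.omegaPlaqsTop s.Ω (Node00.suppDomOfRecord F ν Kt s.Ω) j)
                (ε₀ * (F.P Kt).eta j ^ 2) U) ∧
              Node00.Sect2.CoDivClassOnTop s.Ω (Node00.suppDomOfRecord F ν Kt s.Ω) k' ε₀ U}
            (genSet s.Ω k') W U₁ →
          IsMinimizer (Node00.avOfRecord F 2 Kt)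
            {U | (∀ j, j ≤ k' → PlaqSmallOn (Node00.Sect2.omegaPlaqsTop s.Ω (Node00.suppDomOfRecord F ν Kt s.Ω) j)
                (ε₀ * (F.P Kt).eta j ^ 2) U) ∧
              Node00.Sect2.CoDivClassOnTop s.Ω (Node00.suppDomOfRecord F ν Kt s.Ω) k' ε₀ U}
            (genSet s.Ω k') W U₂ →
          ∃ u : GaugeTransf (F.P Kt) 0 SU2,
            (∀ j, j ≤ k' → ∀ b ∈ bondsOf (genSet s.Ω k' j), toMS u j b.src = toMS u j b.tgt ∧ ∀ g : SU2, toMS u j b.src * g = g * toMS u j b.src) ∧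
              gaugeAct u U₁ = U₂ := by
  intro k' hk' _ _ s hsep
  obtain ⟨s₁, hΩ₁, -⟩ := exists_seq_reindex_Ω s (Node00.DOfRecord F ν ν.M₁ (fun _ => (1 : ℝ)) Kt) fun j h1 hj => by
    rw [B15Prop1Thm1RowsOfExistsUnique.DOfRecord_at_flat]; exact s.chain.memΩ j h1 hj
  have h := h15EU ν ν.M₁ (fun _ => (1 : ℝ)) Kt k' s₁ hk' ((seqSeparated_iff_of_Ω_eq ν.M₁ hΩ₁).2 hsep)
  rw [hΩ₁] at h
  exact h

end HouseShape

end Literature.MathematicalPhysics.QuantumFieldTheory.Balaban1983to89.B15Prop1Thm1RowsOfExistsUniquePos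

end
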